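import Mathlib.Data.ZMod.Basic
import HarnessLib

-- the Theorems namespace of this sub repeats the summit name by design (D-0017 nested layout)
set_option linter.dupNamespace false
set_option autoImplicit false

/-!
# LINE 17 · K1⁺ — the `decide`-sized FINITE STEPS of the all-level proof of `PhantomLineAtTwo`
(crux U1 = stmt-BirchSwinnertonDyer-28083, support toward S2 `CoreRigidityAtTwo`; AUTHORED by the route pen bsd-idea-1 g13
(HOME `line17/PhantomFiniteSteps.lean`, sha16 21accd172794e7b0, memo `line17/K1_row_memo_g13.md` § v3), LANDED verbatim up to the namespace by
width seat krr2-p2 g17 as the first brick of the K1⁺ formalisation (`--supports stmt-BirchSwinnertonDyer-28083 --as helper`); BSD / U1 / S2 NOT proved)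

Coordinates: a matrix `X ∈ 𝔤𝔩₂(𝔽₂)` is `(a, b, c, d) = [[a, b], [c, d]]`, a vector of `V = 𝔽₂²` is `(x, y)`; `S₃ = GL₂(𝔽₂)` is generated by
`s = [[0,1],[1,0]]` and `t = [[1,1],[0,1]]` (both involutions, `st` of order 3), acting on `V` by `s•(x,y) = (y,x)`, `t•(x,y) = (x+y, y)` and on
`𝔤𝔩₂` by conjugation: `s X s⁻¹ = [[d,c],[b,a]]`, `t X t⁻¹ = [[a+c, a+b+c+d],[c, c+d]]`.  Everything below is kernel-checked by `decide`
(no `native_decide`).  These are steps (3)(b), (4) and the two vanishing facts `V^{S₃} = 0`, `H¹(S₃, V) = 0` of the memo's THEOREM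
(`|H¹(GL₂(ℤ/2^k), (ℤ/2^j)²)| ≤ 2`, all `k ≥ 2`); steps (1), (2), (3)(a) are inflation–restriction / a two-line induction and are not finite checks.
BSD, U1, S2 are NOT proved here. -/

namespace Summit.BirchSwinnertonDyer.BirchSwinnertonDyer.Theorems.KolyvaginAtTwo.PhantomFinite

/-- `V^{S₃} = 0`: no non-zero vector of `𝔽₂²` is fixed by both generators. [folklore] -/
theorem fixed_vector_trivial :
    ∀ x y : ZMod 2, ((y, x) = (x, y) ∧ (x + y, y) = (x, y)) → (x, y) = (0, 0) := by
  decide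

/-- `H¹(S₃, V) = 0` in generator form: a crossed homomorphism on `⟨s, t | s², t², (st)³⟩` is determined by `(f s, f t) = ((p,q),(u,v))`
subject to `f(s²) = (1+s) f(s) = 0`, `f(t²) = (1+t) f(t) = 0`, `f((st)³) = (1 + st + (st)²) f(st) = 0` with `f(st) = f(s) + s f(t)`;
every solution is a coboundary `g ↦ g w − w`.  (`st = [[0,1],[1,1]]` acts by `(x,y) ↦ (y, x+y)`, `(st)² : (x,y) ↦ (x+y, x)`.) [folklore] -/
theorem h1_S3_V_trivial :
    ∀ p q u v : ZMod 2,
      (-- (1 + s) f(s) = 0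
       (p + q, q + p) = (0, 0) ∧
       -- (1 + t) f(t) = 0
       (u + (u + v), v + v) = (0, 0) ∧
       -- (1 + st + (st)²) f(st) = 0, where f(st) = f(s) + s f(t) = (p + v, q + u) =: (m, n):
       --   (m, n) + (n, m + n) + (m + n, m) = (0, 0)
       ((p + v) + (q + u) + ((p + v) + (q + u)), (q + u) + ((p + v) + (q + u)) + (p + v)) = (0, 0)) →
      ∃ w₁ w₂ : ZMod 2, (p, q) = (w₂ + w₁, w₁ + w₂) ∧ (u, v) = ((w₁ + w₂) + w₁, w₂ + w₂) := by
  decide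

/-- Step (3)(b), Cayley–Hamilton values: `Y + Y² ∈ {0, E, F, I, E+F+I}` for every `Y ∈ 𝔤𝔩₂(𝔽₂)` (entries of `Y + Y·Y` written out). [folklore] -/
theorem square_values :
    ∀ a b c d : ZMod 2,
      let Z := (a + (a * a + b * c), b + (a * b + b * d), c + (c * a + d * c), d + (c * b + d * d))
      Z = (0, 0, 0, 0) ∨ Z = (0, 1, 0, 0) ∨ Z = (0, 0, 1, 0) ∨ Z = (1, 0, 0, 1) ∨ Z = (1, 1, 1, 1) := by
  decide

/-- Step (3)(b), span: every trace-zero `X = [[a,b],[c,a]]` is a sum of two values `Y + Y²`, `Y' + Y'²` — so an additive map killing all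
squares kills `1 + 4·𝔰𝔩₂(𝔽₂)`. [folklore] -/
theorem traceZero_sum_of_two_square_values :
    ∀ a b c : ZMod 2, ∃ e f g h e' f' g' h' : ZMod 2,
      (a, b, c, a) =
        ((e + (e * e + f * g)) + (e' + (e' * e' + f' * g')),
         (f + (e * f + f * h)) + (f' + (e' * f' + f' * h')),
         (g + (g * e + h * g)) + (g' + (g' * e' + h' * g')),
         (h + (g * f + h * h)) + (h' + (g' * f' + h' * h'))) := by
  decide

/-- Step (4): the `S₃`-equivariant 𝔽₂-linear maps `f : 𝔤𝔩₂(𝔽₂) → V` (given by the images `f11 f12 f21 f22 ∈ V` of `E₁₁, E₁₂, E₂₁, E₂₂`,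
equivariance tested under the generators `s, t` on all sixteen `X`) are EXACTLY `0` and
`φ₀ : E₁₁ ↦ (1,1), E₁₂ ↦ (1,0), E₂₁ ↦ (0,1), E₂₂ ↦ (1,1)` — so `dim Hom_{S₃}(𝔤𝔩₂(𝔽₂), V) = 1` and `φ₀(I) = 0`. [folklore] -/
theorem equivariant_maps_gl2_to_V :
    ∀ f11 f12 f21 f22 : ZMod 2 × ZMod 2,
      (∀ a b c d : ZMod 2,
        -- f(X) for X = (a,b,c,d), linear extension
        let fX : ZMod 2 × ZMod 2 := (a * f11.1 + b * f12.1 + c * f21.1 + d * f22.1, a * f11.2 + b * f12.2 + c * f21.2 + d * f22.2)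
        -- s X s⁻¹ = (d, c, b, a);  s • (x, y) = (y, x)
        let fsX : ZMod 2 × ZMod 2 := (d * f11.1 + c * f12.1 + b * f21.1 + a * f22.1, d * f11.2 + c * f12.2 + b * f21.2 + a * f22.2)
        -- t X t⁻¹ = (a + c, a + b + c + d, c, c + d);  t • (x, y) = (x + y, y)
        let ftX : ZMod 2 × ZMod 2 :=
          ((a + c) * f11.1 + (a + b + c + d) * f12.1 + c * f21.1 + (c + d) * f22.1,
           (a + c) * f11.2 + (a + b + c + d) * f12.2 + c * f21.2 + (c + d) * f22.2)
        fsX = (fX.2, fX.1) ∧ ftX = (fX.1 + fX.2, fX.2)) →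
      (f11, f12, f21, f22) = ((0, 0), (0, 0), (0, 0), (0, 0)) ∨ (f11, f12, f21, f22) = ((1, 1), (1, 0), (0, 1), (1, 1)) := by
  decide

end Summit.BirchSwinnertonDyer.BirchSwinnertonDyer.Theorems.KolyvaginAtTwo.PhantomFinite
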